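import Summits.BirchSwinnertonDyer.BirchSwinnertonDyer.Theorems.PrintCFramBottomClassIndexLawFiveLeCuspSeedCutResidueTerm
import Mathlib.Analysis.PSeries
import HarnessLib

set_option autoImplicit false

/-!
# Crux `PrintCFram.BottomClassIndexLawFiveLe` (stmt-BirchSwinnertonDyer-20372), line `eisenstein-resource-bdp-line` (registry v24/v25):
# (E3) OF THE CUSP-CONJUNCT ASSEMBLY, ANALYTIC PART 2 — ABSOLUTE CONVERGENCE OF THE CUT COHEN `L`-SERIES IN `Re s > k + 1/2`
# (cell `bsd-print-cfram`, width seat `bsd-line-cfram-p1-w5` g6; THEOREMS ONLY, `--supports` 20372; BSD is not proved by any of this)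

HONEST FRAMING. Elementary majorants; nothing modular. For `e` a fundamental discriminant or `1`, `m = |e|`, `k ≥ 2`, parity
`(−1)^k m = −e`, the Dirichlet series `Σ_{a ∈ CUT} H(k,a) a^{−s}` of the (3,0)-`m`-cut Cohen sequence of the registered stub `stub_cuspCutForm`
(its `G` before reduction mod `p`) converges absolutely for `Re s > k + 1/2` (`w = k + 1/2` = the weight of the cut Cohen–Eisenstein series):
**`LSeriesSummable_ite_cut_cohenH`**. This is the hypothesis «`∀ s > w, LSeriesSummable a s`» of (E4)
(`CuspSeed.tendsto_sub_mul_LSeries_of_tendsto_rpow_smul_tsum`, p695659) for this sequence, and the licence for the rearrangements of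
part 3. Majorant on the `(N, f)` side (via `CuspSeed.summable_ite_cut_iff_summable_prod`, p695886): `|L(1−k,χ_D)| ≤ c_k π^{−k}ζ(k)·|D|^{k−1}√|D|`
(`norm_lValueDisc_le`), `|T_k(D,f)| ≤ S_k(f) = Σ_{d∣f} d^{k−1}σ_{2k−1}(f/d)` (`norm_cohenT_le`), `Σ S_k(f) f^{−u} < ∞` for `Re u > 2k`
(`LSeriesSummable_majorant`). [folklore] References: [Cohen1975] §2.
-/

-- summit-side namespace `Summit.BirchSwinnertonDyer.BirchSwinnertonDyer.…` (single-conjunct summit, D-0017 layout)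
set_option linter.dupNamespace false

namespace Summit.BirchSwinnertonDyer.BirchSwinnertonDyer.Theorems.PrintCFram.CuspSeed

open LSeries ArithmeticFunction Literature.NumberTheory.ModularForms.CohenEisenstein
  Literature.NumberTheory.QuadraticFields
open scoped LSeries.notation ArithmeticFunction.Moebius ArithmeticFunction.sigma NumberTheorySymbols Classical

/-! ## §1 Uniform bounds for `L(1 − k, χ_D)` and `T_k(D, f)` -/

/-- `|Σ_a χ_D(a) a^{−k}| ≤ Σ_a a^{−k}` (`k ≥ 2`). [folklore] -/
theorem norm_LSeries_chiDisc_le (D : ℤ) {k : ℕ} (hk : 2 ≤ k) :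
    ‖LSeries (fun a : ℕ ↦ (chiDisc D a : ℂ)) k‖ ≤ ∑' a : ℕ, ‖term (fun _ : ℕ ↦ (1 : ℂ)) k a‖ := by
  have hk1 : (1 : ℝ) < (k : ℂ).re := by simp only [Complex.natCast_re]; exact_mod_cast hk
  have h1 : Summable fun n : ℕ ↦ ‖term (fun _ : ℕ ↦ (1 : ℂ)) k n‖ :=
    (LSeriesSummable_of_le_const_mul_rpow hk1 ⟨1, fun n _ ↦ by simp⟩).norm
  refine (norm_tsum_le_tsum_norm ?_).trans (Summable.tsum_le_tsum (fun a ↦ ?_) ?_ h1)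
  · exact h1.of_nonneg_of_le (fun _ ↦ norm_nonneg _) fun a ↦ norm_term_le k (by
      rcases chiDisc_trichotomy D a with h | h | h <;> rw [h] <;> simp)
  · exact norm_term_le k (by rcases chiDisc_trichotomy D a with h | h | h <;> rw [h] <;> simp)
  · exact h1.of_nonneg_of_le (fun _ ↦ norm_nonneg _) fun a ↦ norm_term_le k (by
      rcases chiDisc_trichotomy D a with h | h | h <;> rw [h] <;> simp)

/-- `|T_k(D, f)| ≤ S_k(f) := Σ_{d ∣ f} d^{k−1} σ_{2k−1}(f/d)` — a bound independent of `D`. [folklore] -/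
theorem norm_cohenT_le (k : ℕ) (D : ℤ) (f : ℕ) :
    ‖(cohenT k D f : ℂ)‖ ≤ ∑ d ∈ f.divisors, ((d : ℝ) ^ (k - 1) * (σ (2 * k - 1) (f / d) : ℝ)) := by
  simp only [cohenT, Int.cast_sum, Int.cast_mul, Int.cast_pow, Int.cast_natCast]
  refine (norm_sum_le _ _).trans (Finset.sum_le_sum fun d _ ↦ ?_)
  rw [norm_mul, norm_mul, norm_mul, norm_pow, Complex.norm_natCast, Complex.norm_natCast, Complex.norm_intCast,
    Complex.norm_intCast]
  have h1 : |(μ d : ℝ)| ≤ 1 := by exact_mod_cast abs_moebius_le_one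
  have h2 : |(chiDisc D d : ℝ)| ≤ 1 := by rcases chiDisc_trichotomy D d with h | h | h <;> rw [h] <;> simp
  calc |(μ d : ℝ)| * |(chiDisc D d : ℝ)| * (d : ℝ) ^ (k - 1) * (σ (2 * k - 1) (f / d) : ℝ)
      ≤ 1 * 1 * (d : ℝ) ^ (k - 1) * (σ (2 * k - 1) (f / d) : ℝ) := by gcongr
    _ = (d : ℝ) ^ (k - 1) * (σ (2 * k - 1) (f / d) : ℝ) := by ring

/-- The majorant `S_k = id^{k−1} ⋆ σ_{2k−1}` has an absolutely convergent Dirichlet series for `Re u > 2k` (`k ≥ 1`).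
[folklore] -/
theorem LSeriesSummable_majorant {k : ℕ} (hk : 1 ≤ k) {u : ℂ} (hu : 2 * (k : ℝ) < u.re) :
    LSeriesSummable (fun f : ℕ ↦ ((∑ d ∈ f.divisors, ((d : ℝ) ^ (k - 1) * (σ (2 * k - 1) (f / d) : ℝ)) : ℝ) : ℂ)) u := by
  have hk' : (1 : ℝ) ≤ k := by exact_mod_cast hk
  -- as a convolution `(pow (k-1)) ⋆ (𝟙 ⋆ pow (2k-1))` of `ℕ → ℂ` sequences
  have heq : (fun f : ℕ ↦ ((∑ d ∈ f.divisors, ((d : ℝ) ^ (k - 1) * (σ (2 * k - 1) (f / d) : ℝ)) : ℝ) : ℂ)) =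
      (fun d : ℕ ↦ (d : ℂ) ^ (k - 1)) ⍟ ((fun _ : ℕ ↦ (1 : ℂ)) ⍟ (fun b : ℕ ↦ (b : ℂ) ^ (2 * k - 1))) := by
    rw [← sigma_eq_convolution]
    funext f
    rw [convolution_def]
    push_cast
    exact (Nat.sum_divisorsAntidiagonal (n := f) (f := fun d e ↦ (d : ℂ) ^ (k - 1) * ((σ (2 * k - 1) e : ℕ) : ℂ))).symm
  rw [heq]
  have hA : LSeriesSummable (fun d : ℕ ↦ (d : ℂ) ^ (k - 1)) u := by
    have := LSeriesSummable_ite_coprime_pow 1 (k - 1) (s := u)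
      (by rw [Nat.cast_sub hk, Nat.cast_one, sub_add_cancel]; linarith)
    exact (LSeriesSummable_congr u fun {n} _ ↦ by rw [if_pos (Nat.coprime_one_right n)]).mp this
  have hB : LSeriesSummable (fun _ : ℕ ↦ (1 : ℂ)) u := by
    have := LSeriesSummable_ite_coprime_one 1 (s := u) (by linarith)
    exact (LSeriesSummable_congr u fun {n} _ ↦ by rw [if_pos (Nat.coprime_one_right n)]).mp this
  have hC : LSeriesSummable (fun b : ℕ ↦ (b : ℂ) ^ (2 * k - 1)) u := by
    have := LSeriesSummable_ite_coprime_pow 1 (2 * k - 1) (s := u)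
      (by rw [Nat.cast_sub (by omega), Nat.cast_mul, Nat.cast_two, Nat.cast_one, sub_add_cancel]; exact hu)
    exact (LSeriesSummable_congr u fun {n} _ ↦ by rw [if_pos (Nat.coprime_one_right n)]).mp this
  exact hA.convolution (hB.convolution hC)

/-- `|L(1−k, χ_D)| ≤ c_k π^{−k} ζ(k) · |D|^{k−1} √|D|` for `D` fundamental (or `1`) of the parity of `k ≥ 2`. [folklore] -/
theorem norm_lValueDisc_le {D : ℤ}
    (hD : D = 1 ∨ (D % 4 = 1 ∧ Squarefree D ∧ D ≠ 1) ∨ (4 ∣ D ∧ (D / 4 % 4 = 2 ∨ D / 4 % 4 = 3) ∧ Squarefree (D / 4)))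
    {k : ℕ} (hk : 2 ≤ k) (hpar : (0 < D ∧ Even k) ∨ (D < 0 ∧ Odd k)) :
    ‖(lValueDisc k D : ℂ)‖ ≤ ‖(-1 : ℂ) ^ (k / 2) * ((k - 1).factorial : ℂ) / 2 ^ (k - 1) / (Real.pi : ℂ) ^ k‖ *
      (∑' a : ℕ, ‖term (fun _ : ℕ ↦ (1 : ℂ)) k a‖) * ((D.natAbs : ℝ) ^ (k - 1) * Real.sqrt D.natAbs) := by
  rw [ratCast_lValueDisc_eq_mul_LSeries hD hk hpar]
  rw [show (-1 : ℂ) ^ (k / 2) * ((k - 1).factorial : ℂ) / 2 ^ (k - 1) * (D.natAbs : ℂ) ^ (k - 1) *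
        (Real.sqrt D.natAbs : ℂ) / (Real.pi : ℂ) ^ k * LSeries (fun a : ℕ ↦ (chiDisc D a : ℂ)) k =
      ((-1 : ℂ) ^ (k / 2) * ((k - 1).factorial : ℂ) / 2 ^ (k - 1) / (Real.pi : ℂ) ^ k) *
        LSeries (fun a : ℕ ↦ (chiDisc D a : ℂ)) k * ((D.natAbs : ℂ) ^ (k - 1) * (Real.sqrt D.natAbs : ℂ)) by ring]
  rw [norm_mul, norm_mul, norm_mul, norm_pow, Complex.norm_natCast, Complex.norm_real,
    Real.norm_of_nonneg (Real.sqrt_nonneg _)]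
  gcongr
  exact norm_LSeries_chiDisc_le D hk

/-! ## §2 Absolute convergence of the cut Cohen series for `Re s > k + 1/2` -/

/-- **The cut Cohen `L`-series converges absolutely for `Re s > k + 1/2`.** For `e` a fundamental discriminant or `1`,
`m = |e|`, `k ≥ 2`, parity `(−1)^k m = −e`: the Dirichlet series `Σ_{a ∈ CUT} H(k, a) a^{−s}` of the (3,0)-`m`-cut Cohen sequence
(the `G` of `stub_cuspCutForm`, before reduction) converges absolutely in `Re s > k + 1/2` — the abscissa is `w = k + 1/2`, the weight
of the cut Cohen–Eisenstein series. (Majorant on the `(N, f)` side: `|H(k, mNf²)| ≤ c (mN)^{k−1/2} · S_k(f)`, `S_k = id^{k−1} ⋆ σ_{2k−1}`.)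
This is the hypothesis «`∀ s > w, LSeriesSummable a s`» of (E4) `CuspSeed.tendsto_sub_mul_LSeries_of_tendsto_rpow_smul_tsum` for
this sequence. [cite: Cohen1975, §2 (definition of h(r,N) and of H(r,N))] -/
theorem LSeriesSummable_ite_cut_cohenH {e : ℤ}
    (he : e = 1 ∨ (e % 4 = 1 ∧ Squarefree e ∧ e ≠ 1) ∨ (4 ∣ e ∧ (e / 4 % 4 = 2 ∨ e / 4 % 4 = 3) ∧ Squarefree (e / 4)))
    {m : ℕ} (hme : e.natAbs = m) {k : ℕ} (hk : 2 ≤ k) (hsign : (-1 : ℤ) ^ k * m = -e) {s : ℂ} (hs : (k : ℝ) + 1 / 2 < s.re) :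
    LSeriesSummable (fun a : ℕ ↦ if m ∣ a ∧ a / m % 4 = 3 ∧
        (∀ q : ℕ, q.Prime → q ∣ m → q ≠ 2 → J(-((a / m : ℕ) : ℤ) | q) = 1) ∧ (2 ∣ m → a / m % 8 = 7) ∧ ¬ 3 ∣ a / m
        then (cohenH k a : ℂ) else 0) s := by
  have hk1 : 1 ≤ k := by omega
  have he0 : e ≠ 0 := by
    rintro rfl
    rcases he with h | ⟨h, -, -⟩ | ⟨-, h, -⟩ <;> norm_num at h
  have hm : m ≠ 0 := by rw [← hme]; exact Int.natAbs_ne_zero.mpr he0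
  -- the terms in `ite` form
  set g : ℕ → ℂ := fun a ↦ (cohenH k a : ℂ) / (a : ℂ) ^ s with hg
  have hterm : ∀ a : ℕ, term (fun a : ℕ ↦ if m ∣ a ∧ a / m % 4 = 3 ∧
      (∀ q : ℕ, q.Prime → q ∣ m → q ≠ 2 → J(-((a / m : ℕ) : ℤ) | q) = 1) ∧ (2 ∣ m → a / m % 8 = 7) ∧ ¬ 3 ∣ a / m
      then (cohenH k a : ℂ) else 0) s a =
      if m ∣ a ∧ a / m % 4 = 3 ∧ (∀ q : ℕ, q.Prime → q ∣ m → q ≠ 2 → J(-((a / m : ℕ) : ℤ) | q) = 1) ∧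
        (2 ∣ m → a / m % 8 = 7) ∧ ¬ 3 ∣ a / m then g a else 0 := by
    intro a
    rcases eq_or_ne a 0 with rfl | ha
    · rw [term_zero, if_neg]
      rintro ⟨-, h4, -⟩
      rw [Nat.zero_div] at h4
      omega
    · rw [term_of_ne_zero ha]
      split_ifs <;> simp [hg]
  unfold LSeriesSummable
  rw [summable_congr hterm, summable_ite_cut_iff_summable_prod hm g]
  -- the majorants
  set c₀ : ℝ := ‖(-1 : ℂ) ^ (k / 2) * ((k - 1).factorial : ℂ) / 2 ^ (k - 1) / (Real.pi : ℂ) ^ k‖ *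
    (∑' a : ℕ, ‖term (fun _ : ℕ ↦ (1 : ℂ)) k a‖) with hc₀
  have hc₀nn : 0 ≤ c₀ := mul_nonneg (norm_nonneg _) (tsum_nonneg fun _ ↦ norm_nonneg _)
  set x : ℝ := (k : ℝ) - 1 / 2 - s.re with hx
  have hx1 : x < -1 := by rw [hx]; linarith
  set B₁ : ℕ → ℝ := fun N ↦ c₀ * (m : ℝ) ^ x * (N : ℝ) ^ x with hB₁
  set B₂ : ℕ → ℝ := fun f ↦ ‖term (fun f : ℕ ↦ ((∑ d ∈ f.divisors, ((d : ℝ) ^ (k - 1) * (σ (2 * k - 1) (f / d) : ℝ)) : ℝ) : ℂ))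
    (2 * s) f‖ with hB₂
  have hB₁s : Summable B₁ := (Real.summable_nat_rpow.mpr hx1).mul_left _
  have hB₂s : Summable B₂ := (LSeriesSummable_majorant hk1 (u := 2 * s)
    (by simp only [Complex.mul_re, Complex.re_ofNat, Complex.im_ofNat, zero_mul, sub_zero]; linarith)).norm
  have hB₁nn : ∀ N, 0 ≤ B₁ N := fun N ↦ by positivity
  have hB₂nn : ∀ f, 0 ≤ B₂ f := fun f ↦ norm_nonneg _
  refine Summable.of_norm_bounded (Summable.mul_of_nonneg hB₁s hB₂s hB₁nn hB₂nn) fun y ↦ ?_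
  obtain ⟨N, f⟩ := y
  simp only
  split_ifs with hNf
  swap
  · rw [norm_zero]; exact mul_nonneg (hB₁nn N) (hB₂nn f)
  obtain ⟨⟨hN, hN4, h8, hJ, h3⟩, hcop⟩ := hNf
  have hf0 : f ≠ 0 := by
    rintro rfl
    rw [Nat.coprime_zero_left] at hcop
    omega
  have hN0 : N ≠ 0 := hN.ne_zero
  -- Cohen's formula and the shape of the term
  rw [hg]
  simp only
  rw [cohenH_mul_mul_sq_eq he hme hsign hN hN4 hJ hf0]
  push_cast
  -- facts about `D = e·(−N)`
  have hDabs : (e * -(N : ℤ)).natAbs = m * N := by rw [Int.natAbs_mul, Int.natAbs_neg, Int.natAbs_natCast, hme]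
  have hDf := CohenCut.isFundamental_mul_neg he hN4 hN (hme ▸ coprime_of_family hN4 hJ)
  have hpar : (0 < e * -(N : ℤ) ∧ Even k) ∨ (e * -(N : ℤ) < 0 ∧ Odd k) := by
    have hNpos : (0 : ℤ) < N := by exact_mod_cast Nat.pos_of_ne_zero hN0
    have hmpos : (0 : ℤ) < m := by exact_mod_cast Nat.pos_of_ne_zero hm
    rcases Nat.even_or_odd k with hke | hko
    · left; refine ⟨?_, hke⟩; rw [hke.neg_one_pow, one_mul] at hsign; nlinarith
    · right; refine ⟨?_, hko⟩; rw [hko.neg_one_pow] at hsign; nlinarith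
  have hL := norm_lValueDisc_le (Or.inr hDf) hk hpar
  rw [hDabs] at hL
  have hT := norm_cohenT_le k (e * -(N : ℤ)) f
  -- norms of the powers
  have hmN : (0 : ℝ) < (m : ℝ) * N := by positivity
  have hf' : (0 : ℝ) < f := by exact_mod_cast Nat.pos_of_ne_zero hf0
  have hden : ‖((m : ℂ) * ((N : ℂ) * (f : ℂ) ^ 2)) ^ s‖ = ((m : ℝ) * N) ^ s.re * ((f : ℝ) ^ 2) ^ s.re := by
    rw [show ((m : ℂ) * ((N : ℂ) * (f : ℂ) ^ 2)) = ((m * (N * f ^ 2) : ℕ) : ℂ) by push_cast; ring,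
      Complex.norm_natCast_cpow_of_pos (Nat.pos_of_ne_zero (mul_ne_zero hm (mul_ne_zero hN0 (pow_ne_zero 2 hf0)))),
      Nat.cast_mul, Nat.cast_mul, Nat.cast_pow, ← mul_assoc, Real.mul_rpow hmN.le (by positivity)]
  have hS : 0 ≤ ∑ d ∈ f.divisors, ((d : ℝ) ^ (k - 1) * (σ (2 * k - 1) (f / d) : ℝ)) :=
    Finset.sum_nonneg fun _ _ ↦ by positivity
  have hB₂f : B₂ f = (∑ d ∈ f.divisors, ((d : ℝ) ^ (k - 1) * (σ (2 * k - 1) (f / d) : ℝ))) / ((f : ℝ) ^ 2) ^ s.re := by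
    rw [hB₂]
    simp only
    rw [norm_term_eq, if_neg hf0, Complex.norm_real, Real.norm_of_nonneg hS, Complex.mul_re]
    simp only [Complex.re_ofNat, Complex.im_ofNat, zero_mul, sub_zero]
    rw [Real.rpow_mul hf'.le, Real.rpow_two]
  have hB₁N : B₁ N = c₀ * (((m : ℝ) * N) ^ (k - 1) * Real.sqrt ((m : ℝ) * N) / ((m : ℝ) * N) ^ s.re) := by
    rw [hB₁]
    simp only
    rw [Real.sqrt_eq_rpow, ← Real.rpow_natCast _ (k - 1), ← Real.rpow_add hmN, ← Real.rpow_sub hmN,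
      Real.mul_rpow (by positivity) (by positivity), mul_assoc]
    congr 2 <;> (rw [hx]; push_cast [Nat.cast_sub hk1]; ring)
  rw [norm_div, norm_mul, hden, hB₂f, hB₁N]
  have hL' : ‖(lValueDisc k (e * -(N : ℤ)) : ℂ)‖ ≤ c₀ * (((m : ℝ) * N) ^ (k - 1) * Real.sqrt ((m : ℝ) * N)) := by
    simpa only [Nat.cast_mul, hc₀] using hL
  calc ‖(lValueDisc k (e * -(N : ℤ)) : ℂ)‖ * ‖(cohenT k (e * -(N : ℤ)) f : ℂ)‖ / (((m : ℝ) * N) ^ s.re * ((f : ℝ) ^ 2) ^ s.re)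
      ≤ c₀ * (((m : ℝ) * N) ^ (k - 1) * Real.sqrt ((m : ℝ) * N)) *
          (∑ d ∈ f.divisors, ((d : ℝ) ^ (k - 1) * (σ (2 * k - 1) (f / d) : ℝ))) / (((m : ℝ) * N) ^ s.re * ((f : ℝ) ^ 2) ^ s.re) := by
        gcongr
    _ = c₀ * (((m : ℝ) * N) ^ (k - 1) * Real.sqrt ((m : ℝ) * N) / ((m : ℝ) * N) ^ s.re) *
          ((∑ d ∈ f.divisors, ((d : ℝ) ^ (k - 1) * (σ (2 * k - 1) (f / d) : ℝ))) / ((f : ℝ) ^ 2) ^ s.re) := by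
        have h1 : ((m : ℝ) * N) ^ s.re ≠ 0 := (Real.rpow_pos_of_pos hmN _).ne'
        have h2 : ((f : ℝ) ^ 2) ^ s.re ≠ 0 := (Real.rpow_pos_of_pos (by positivity) _).ne'
        field_simp


end Summit.BirchSwinnertonDyer.BirchSwinnertonDyer.Theorems.PrintCFram.CuspSeed
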